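import Mathlib.Algebra.Field.ZMod
import Mathlib.Data.Real.Basic
import Mathlib.Data.Set.Card
import Mathlib.LinearAlgebra.Matrix.Charpoly.Coeff
import Mathlib.RepresentationTheory.Maschke
import Literature.NumberTheory.GaloisRepresentations.ContinuousRep
import HarnessLib

/-!
# Deligne–Serre 1974, §7: a bound for the order of certain subgroups of `GL₂(𝔽_ℓ)`

Deligne–Serre, *Formes modulaires de poids 1*, Ann. Sci. ÉNS (4) 7 (1974), §7 ("Majoration des
ordres de certains sous-groupes de `GL₂(𝔽_ℓ)`"), the group-theoretic input of the proof of their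
Thm. 4.1 (weight-one forms give Artin representations): via Lemme 8.3–8.4 it bounds, uniformly
in `ℓ`, the images `G_ℓ` of the mod-`ℓ` representations attached to a weight-one eigenform.

* `Literature.DeligneSerre1974.HasPropertyC G η M` — property **C(η, M)** of §7.1 for a subgroup
  `G ⊆ GL₂(𝔽_ℓ)`: there is a subset `H ⊆ G` with `|H| ≥ (1 - η) |G|` such that the set of
  polynomials `det(1 - hT)`, `h ∈ H`, has at most `M` elements.
* `Literature.DeligneSerre1974.IsSemisimpleSubgroup G` — "`G` est semi-simple si la représentation
  identique `G → GL₂(𝔽_ℓ)` est semi-simple" (§7.1): Mathlib's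
  `Representation.IsSemisimpleRepresentation` of the standard representation
  (`Literature.NumberTheory.GaloisRepresentations.glStdRepresentation`, trunk GalRep) restricted to `G`.
* `Literature.NumberTheory.GaloisRepresentations.DeligneSerre1974.prop72` — **Prop. 7.2** as a named fact (D-0014): for `0 ≤ η < 1/2` and
  `M ≥ 0` there is `A = A(η, M)` such that every semisimple subgroup `G ⊆ GL₂(𝔽_ℓ)`, `ℓ` any
  prime, with property C(η, M) has `|G| ≤ A`. The printed proof is a case analysis over
  Dickson's classification of the subgroups of `GL₂(𝔽_ℓ)` (Serre, *Propriétés galoisiennes des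
  points d'ordre fini des courbes elliptiques*, Invent. Math. 15 (1972), §2, Prop. 15–16), which
  Mathlib does not have; hence a named fact.

## Design notes

* `𝔽_ℓ = ZMod ℓ` with `[Fact ℓ.Prime]` throughout (for other `ℓ` the notions would be junk:
  `ZMod 0 = ℤ`, and semisimplicity needs a field); `GL₂(𝔽_ℓ) = GL (Fin 2) (ZMod ℓ)`
  (`Matrix.GeneralLinearGroup`), acting on `Fin 2 → ZMod ℓ` through the standard representation
  `Literature.glStdRepresentation (Fin 2) (ZMod ℓ)` (= Mathlib's `Representation.ofDistribMulAction`
  for the `Matrix`-action on column vectors); `det(1 - hT)` is Mathlib's `Matrix.charpolyRev`.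
  Using `Representation.IsSemisimpleRepresentation` (rather than an unfolded "every stable line
  has a stable complement") lets consumers of `(h : prop72)` feed it the images of semisimple
  representations (Thm. 6.7, Lemme 8.4) without a bridging lemma.
* `η` is a real number and `M` a natural number ("deux nombres positifs", §7.1; only
  `|X| ≤ M` for finite sets `X` is used); the subset `H` is a `Finset` and the number of
  polynomials is a `Set.ncard` of a (finite) image.
* Mathlib has neither Dickson's classification nor any bound of this kind (searched
  `Dickson`, `GL (Fin 2)`, `charpolyRev` users); Maschke (`RepresentationTheory.Maschke`) gives
  the sanity lemma `isSemisimpleSubgroup_of_not_dvd_card`.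

## References

* P. Deligne, J.-P. Serre, *Formes modulaires de poids 1*, Ann. Sci. ÉNS (4) 7 (1974), 507–530,
  §7.1 and Prop. 7.2 (pp. 523–524).
* J.-P. Serre, *Propriétés galoisiennes des points d'ordre fini des courbes elliptiques*, Invent.
  Math. 15 (1972), 259–331, §2.
-/

namespace Literature.NumberTheory.GaloisRepresentations.DeligneSerre1974

open Matrix

variable {ℓ : ℕ} [Fact ℓ.Prime]

/-- **Property C(η, M)** (Deligne–Serre 1974, §7.1) of a subgroup `G` of `GL₂(𝔽_ℓ)`: there is a
subset `H` of `G` with `|H| ≥ (1 - η) |G|` such that the set of polynomials `det(1 - hT)`,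
`h ∈ H`, has at most `M` elements. [cite: DeligneSerreASENS1974, §7.1] -/
def HasPropertyC (G : Subgroup (GL (Fin 2) (ZMod ℓ))) (η : ℝ) (M : ℕ) : Prop :=
  ∃ H : Finset (GL (Fin 2) (ZMod ℓ)), (↑H : Set (GL (Fin 2) (ZMod ℓ))) ⊆ G ∧
    (1 - η) * (Nat.card G : ℝ) ≤ H.card ∧
    ((fun h : GL (Fin 2) (ZMod ℓ) ↦ charpolyRev (h : Matrix (Fin 2) (Fin 2) (ZMod ℓ))) '' H).ncard
      ≤ M

/-- The identical representation `G → GL₂(𝔽_ℓ)` of a subgroup `G`, on `𝔽_ℓ² = Fin 2 → ZMod ℓ`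
(the standard representation `Literature.NumberTheory.GaloisRepresentations.glStdRepresentation` restricted to `G`). [folklore] -/
abbrev subgroupRepresentation (G : Subgroup (GL (Fin 2) (ZMod ℓ))) :
    Representation (ZMod ℓ) G (Fin 2 → ZMod ℓ) :=
  (glStdRepresentation (Fin 2) (ZMod ℓ)).comp G.subtype

/-- A subgroup `G` of `GL₂(𝔽_ℓ)` is **semisimple** (Deligne–Serre 1974, §7.1) if the identical
representation `G → GL₂(𝔽_ℓ)` is semisimple (every subrepresentation of `𝔽_ℓ²` has a
`G`-stable complement: Mathlib `Representation.IsSemisimpleRepresentation`).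
[cite: DeligneSerreASENS1974, §7.1] -/
def IsSemisimpleSubgroup (G : Subgroup (GL (Fin 2) (ZMod ℓ))) : Prop :=
  (subgroupRepresentation G).IsSemisimpleRepresentation

/-- **Deligne–Serre 1974, Prop. 7.2.** Let `η < 1/2` and `M ≥ 0` (`η ≥ 0`, §7.1). There is a
constant `A = A(η, M)` such that for every prime `ℓ` and every semisimple subgroup `G` of
`GL₂(𝔽_ℓ)` with property C(η, M) one has `|G| ≤ A`. (Proof in print: case analysis over
Dickson's list — `G ⊇ SL₂(𝔽_ℓ)`, `G` in a Cartan subgroup, in the normaliser of a Cartan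
subgroup, or with image `𝔄₄`, `𝔖₄`, `𝔄₅` in `PGL₂(𝔽_ℓ)`.)
[cite: DeligneSerreASENS1974, Prop. 7.2] -/
def prop72 : Prop :=
  ∀ (η : ℝ) (M : ℕ), 0 ≤ η → η < 1 / 2 →
    ∃ A : ℕ, ∀ (ℓ : ℕ) [Fact ℓ.Prime] (G : Subgroup (GL (Fin 2) (ZMod ℓ))),
      IsSemisimpleSubgroup G → HasPropertyC G η M → Nat.card G ≤ A

/-! ### Basic API -/

/-- Property C is monotone in `η` and `M`. [folklore] -/
lemma HasPropertyC.mono {G : Subgroup (GL (Fin 2) (ZMod ℓ))} {η η' : ℝ} {M M' : ℕ}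
    (h : HasPropertyC G η M) (hη : η ≤ η') (hM : M ≤ M') : HasPropertyC G η' M' := by
  obtain ⟨H, hHG, hcard, hpoly⟩ := h
  refine ⟨H, hHG, le_trans ?_ hcard, hpoly.trans hM⟩
  have : (0 : ℝ) ≤ Nat.card G := Nat.cast_nonneg _
  nlinarith

/-- The trivial subgroup has property C(η, M) for all `η ≥ 0` and `M ≥ 1` (take `H = {1}`, whose
only polynomial is `det(1 - T) = (1 - T)²`). [folklore] -/
lemma hasPropertyC_bot {η : ℝ} (hη : 0 ≤ η) {M : ℕ} (hM : 1 ≤ M) :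
    HasPropertyC (⊥ : Subgroup (GL (Fin 2) (ZMod ℓ))) η M := by
  refine ⟨{1}, by simp, ?_, ?_⟩
  · simp only [Subgroup.mem_bot, Nat.card_unique, Nat.cast_one, mul_one,
      Finset.card_singleton]
    linarith
  · rw [Finset.coe_singleton, Set.image_singleton, Set.ncard_singleton]
    exact hM

/-- **Maschke**: a subgroup of `GL₂(𝔽_ℓ)` of order prime to `ℓ` is semisimple. [folklore] -/
lemma isSemisimpleSubgroup_of_not_dvd_card (G : Subgroup (GL (Fin 2) (ZMod ℓ)))
    (hG : ¬ ℓ ∣ Nat.card G) : IsSemisimpleSubgroup G := by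
  haveI : NeZero (Nat.card G : ZMod ℓ) := ⟨fun h ↦ hG ((ZMod.natCast_eq_zero_iff _ _).mp h)⟩
  unfold IsSemisimpleSubgroup
  infer_instance

/-- The trivial subgroup is semisimple. [folklore] -/
lemma isSemisimpleSubgroup_bot : IsSemisimpleSubgroup (⊥ : Subgroup (GL (Fin 2) (ZMod ℓ))) :=
  isSemisimpleSubgroup_of_not_dvd_card ⊥ (by
    rw [Nat.card_unique, Nat.dvd_one]
    exact (Fact.out : ℓ.Prime).ne_one)

end Literature.NumberTheory.GaloisRepresentations.DeligneSerre1974
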